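import Literature.Analysis.Matrix.BlockDiagonalEigenvalueCount
import HarnessLib

/-!
# Sector levels from block certificates (flow-data certificate chain, Y3)

A transfer-matrix lineage that diagonalises the symmetry BLOCKS of a flux sector separately
(±1-character / momentum blocks: a real symmetric `A : Matrix ι ι ℝ` with `A i j = 0` whenever the
block labels `c i ≠ c j`) certifies, per block `k`, enclosures of ALL the block's levels
`lo k l ≤ λ↓_l(A_k) ≤ hi k l` (exact inertia counts, residual balls, …).  By Horn–Johnson 1.1.P4 with
multiplicities (`Literature.Analysis.Matrix.BlockDiagonalCount`: eigenvalue counts add over the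
blocks) the SECTOR's `j`-th level is then bracketed by two integer sums over the certified ends:

* `lt_eigenvalues₀_of_block_lower_ends` — `j < Σ_k #{l | a < lo k l} ⇒ a < λ↓_j(A)`;
* `eigenvalues₀_le_of_block_upper_ends` — `Σ_k #{l | b < hi k l} ≤ j ⇒ λ↓_j(A) ≤ b`;
* `eigenvalues₀_mem_Ioc_of_block_ends` — both ⇒ `λ↓_j(A) ∈ (a, b]`,

with no identification of "which block carries level `j`" and with cross-block multiplets handled by
the counts.  This is the reading used for whole-sector levels (`E_k`, `m′`, second/third levels of a
flux sector) of the FLOW-TABLE rows; it is finite-dimensional linear algebra only — no lattice object,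
no continuum / infinite-volume claim.

## References
* [HornJohnson2013] R. A. Horn, C. R. Johnson, *Matrix Analysis*, 2nd ed., CUP 2013 — 1.1.P4 (p0076).
* [GolubVanLoan2013] G. H. Golub, C. F. Van Loan, *Matrix Computations*, 4th ed., 2013 — §8.4.2.
-/

noncomputable section

open scoped Matrix

namespace Summit.Ventures.YMGap.FlowData

namespace SectorLevel

open Finset _root_.Matrix Literature.Analysis.Matrix

variable {𝕜 : Type*} [RCLike 𝕜] {ι κ : Type*} [Fintype ι] [DecidableEq ι] [Fintype κ] [DecidableEq κ]

omit [Fintype κ] [DecidableEq κ] in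
/-- Certified LOWER ends of all levels bound the count above a shift from below:
`#{l | a < lo l} ≤ #{i | a < λ_i(B)}`. -/
theorem card_lower_ends_gt_le {B : Matrix ι ι 𝕜} (hB : B.IsHermitian)
    (lo : Fin (Fintype.card ι) → ℝ) (hlo : ∀ l, lo l ≤ hB.eigenvalues₀ l) (a : ℝ) :
    (univ.filter fun l => a < lo l).card ≤ (univ.filter fun i => a < hB.eigenvalues i).card := by
  by_contra h
  rw [not_le] at h
  -- the index `j := #{i | a < λ_i}` (as a `Fin`) has `λ↓_j ≤ a` but `lo` exceeds `a` at > j places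
  set m := (univ.filter fun i => a < hB.eigenvalues i).card with hm
  have hmn : m < Fintype.card ι := lt_of_lt_of_le h (card_le_univ _ |>.trans (by simp))
  have hle : hB.eigenvalues₀ ⟨m, hmn⟩ ≤ a :=
    BlockDiagonalCount.eigenvalues₀_le_of_card_le hB ⟨m, hmn⟩ le_rfl
  -- every `l` with `a < lo l` has `a < λ↓_l`, hence `l < m` (antitone); so there are at most `m` of them
  have hsub : (univ.filter fun l => a < lo l) ⊆ Iio ⟨m, hmn⟩ := fun l hl => mem_Iio.2 (by
    by_contra hlm
    have h1 : a < hB.eigenvalues₀ l := lt_of_lt_of_le (mem_filter.1 hl).2 (hlo l)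
    have h2 : hB.eigenvalues₀ l ≤ hB.eigenvalues₀ ⟨m, hmn⟩ := hB.eigenvalues₀_antitone (not_lt.1 hlm)
    exact absurd (h1.trans_le (h2.trans hle)) (lt_irrefl a))
  have := card_le_card hsub
  rw [Fin.card_Iio] at this
  simp only at this
  omega

omit [Fintype κ] [DecidableEq κ] in
/-- Certified UPPER ends of all levels bound the count above a shift from above:
`#{i | b < λ_i(B)} ≤ #{l | b < hi l}`. -/
theorem card_gt_le_card_upper_ends {B : Matrix ι ι 𝕜} (hB : B.IsHermitian)
    (hi : Fin (Fintype.card ι) → ℝ) (hhi : ∀ l, hB.eigenvalues₀ l ≤ hi l) (b : ℝ) :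
    (univ.filter fun i => b < hB.eigenvalues i).card ≤ (univ.filter fun l => b < hi l).card := by
  by_contra h
  rw [not_le] at h
  set m := (univ.filter fun l => b < hi l).card with hm
  have hmn : m < Fintype.card ι := lt_of_lt_of_le h (card_le_univ _ |>.trans (by simp))
  have hlt : b < hB.eigenvalues₀ ⟨m, hmn⟩ := BlockDiagonalCount.lt_eigenvalues₀_of_lt_card hB ⟨m, hmn⟩ h
  -- all indices `l ≤ m` have `b < λ↓_l ≤ hi l`: that is `m + 1` upper ends above `b`
  have hsub : Iic (⟨m, hmn⟩ : Fin (Fintype.card ι)) ⊆ (univ.filter fun l => b < hi l) := fun l hl =>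
    mem_filter.2 ⟨mem_univ _,
      lt_of_lt_of_le (lt_of_lt_of_le hlt (hB.eigenvalues₀_antitone (mem_Iic.1 hl))) (hhi l)⟩
  have := card_le_card hsub
  rw [Fin.card_Iic] at this
  simp only at this
  omega

/-- **Sector level, lower end**: per-block certified lower ends `lo k l ≤ λ↓_l(A_k)` of all block
levels and `j < Σ_k #{l | a < lo k l}` give `a < λ↓_j(A)`. -/
theorem lt_eigenvalues₀_of_block_lower_ends {A : Matrix ι ι 𝕜} (hA : A.IsHermitian) (c : ι → κ)
    (hblock : ∀ i j, c i ≠ c j → A i j = 0)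
    (lo : (k : κ) → Fin (Fintype.card {i // c i = k}) → ℝ)
    (hlo : ∀ k l, lo k l ≤ (hA.submatrix (Subtype.val : {i // c i = k} → ι)).eigenvalues₀ l)
    {a : ℝ} (j : Fin (Fintype.card ι))
    (hj : (j : ℕ) < ∑ k, (univ.filter fun l => a < lo k l).card) :
    a < hA.eigenvalues₀ j :=
  BlockDiagonalCount.lt_eigenvalues₀_of_block_counts_ge hA c hblock
    (fun k => card_lower_ends_gt_le (hA.submatrix Subtype.val) (lo k) (hlo k) a) j hj

/-- **Sector level, upper end**: per-block certified upper ends `λ↓_l(A_k) ≤ hi k l` of all block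
levels and `Σ_k #{l | b < hi k l} ≤ j` give `λ↓_j(A) ≤ b`. -/
theorem eigenvalues₀_le_of_block_upper_ends {A : Matrix ι ι 𝕜} (hA : A.IsHermitian) (c : ι → κ)
    (hblock : ∀ i j, c i ≠ c j → A i j = 0)
    (hi : (k : κ) → Fin (Fintype.card {i // c i = k}) → ℝ)
    (hhi : ∀ k l, (hA.submatrix (Subtype.val : {i // c i = k} → ι)).eigenvalues₀ l ≤ hi k l)
    {b : ℝ} (j : Fin (Fintype.card ι))
    (hj : ∑ k, (univ.filter fun l => b < hi k l).card ≤ (j : ℕ)) :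
    hA.eigenvalues₀ j ≤ b :=
  BlockDiagonalCount.eigenvalues₀_le_of_block_counts_le hA c hblock
    (fun k => card_gt_le_card_upper_ends (hA.submatrix Subtype.val) (hi k) (hhi k) b) j hj

/-- **Sector level from block enclosures (certificate form)**: with every block level enclosed,
`lo k l ≤ λ↓_l(A_k) ≤ hi k l`, the two integer sums `Σ_k #{l | b < hi k l} ≤ j < Σ_k #{l | a < lo k l}`
give `λ↓_j(A) ∈ (a, b]`. -/
theorem eigenvalues₀_mem_Ioc_of_block_ends {A : Matrix ι ι 𝕜} (hA : A.IsHermitian) (c : ι → κ)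
    (hblock : ∀ i j, c i ≠ c j → A i j = 0)
    (lo hi : (k : κ) → Fin (Fintype.card {i // c i = k}) → ℝ)
    (hlo : ∀ k l, lo k l ≤ (hA.submatrix (Subtype.val : {i // c i = k} → ι)).eigenvalues₀ l)
    (hhi : ∀ k l, (hA.submatrix (Subtype.val : {i // c i = k} → ι)).eigenvalues₀ l ≤ hi k l)
    {a b : ℝ} (j : Fin (Fintype.card ι))
    (hja : (j : ℕ) < ∑ k, (univ.filter fun l => a < lo k l).card)
    (hjb : ∑ k, (univ.filter fun l => b < hi k l).card ≤ (j : ℕ)) :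
    hA.eigenvalues₀ j ∈ Set.Ioc a b :=
  ⟨lt_eigenvalues₀_of_block_lower_ends hA c hblock lo hlo j hja,
    eigenvalues₀_le_of_block_upper_ends hA c hblock hi hhi j hjb⟩

end SectorLevel

end Summit.Ventures.YMGap.FlowData
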